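import Summits.MatrixMultiplication.MatrixMultiplication.Theorems.OutsiderSandwichBlockNormalForm
import HarnessLib

/-!
# The twist gluing: `C₁^{⊠N}` is ONE matrix read through ALL `2^N` partial transposes

Route `OutsiderSandwich` (decomposition cell `decomp-mm`, lens 4 «minimal counterexample /
extremal reduction», gen 26), support for the aside leaf `BlockOneIsMM`
(stmt-MatrixMultiplication-27147, `⟺ θ⋆ = 0`); the cut of record `closes(LaserTangency,
LaserMergeOptimal, SummitIffLaserTangency)` is untouched.

## The normal form (what a counterexample / certificate must look like)

Index `2^N × 2^N` matrices by bit strings `r s : Fin N → Fin 2` (`Idx N`).  For a pattern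
`c : Fin N → Fin 2` the **partial transpose** `τ_c` (`ptrans c`) swaps the row and column bit at
every position `i` with `c i = 1` (`τ_0 = id`, `τ_{1…1} = ᵀ`, `τ_c τ_{c'} = τ_{c+c'}`,
`τ_{c+1} X = (τ_c X)ᵀ` — the MIRROR LAW).  The structural content of this file:

* (companion file `OutsiderSandwichTwistSlices`) the `x`-slices of `C₁^{⊠N}` are exactly the
  `2^N` partial transposes `τ_c X` of ONE matrix (block `c ↦ c+1`: `(X, v) ↦ τ_c(X) v`), while the
  `x`-slices of `⟨2,2,2⟩^{⊠N}` are `2^N` UNtwisted copies `(X, v) ↦ X v` — one matrix, ALL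
  orientations, one vector each, versus one matrix, ONE orientation, `2^N` vectors.
* `ptrans_ne_sandwich` / `ptrans_not_untwistable` — **no-untwisting lemma**: for `c ≠ 0` there are
  NO matrices `G, H` with `G · τ_c(X) · H = X` for all `X` (over any nontrivial commutative ring):
  acting on the two vector legs alone never untwists a block (`X = 1` forces `G H = 1`, so `τ_c`
  would be multiplicative — it is not, on matrix units differing at one twisted bit).
* `two_pow_le_of_sepCert` — **separable certificates have rate one**: in a certificate for
  `⟨B⟩ ⊠ C₁^{⊠N} ≥ ⟨2,2,2⟩^{⊠N}` in which every target column `X u_d` is produced by a SINGLE block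
  `(copy i_d, pattern c_d)` through vector-leg matrices (`G_d τ_{c_d}(A_{i_d} X) H_d = X`, distinct
  columns using distinct blocks; the `x`-leg maps `A_i` are ARBITRARY functions), each copy serves
  at most one column, so `B ≥ 2^N`.  Hence every certificate beating rate `1` — the level-2
  certificate `⟨2⟩ ⊠ C₁^{⊠2} ≥ ⟨4,4,4⟩` of lens 2 and the symmetric core `⌈(4/3)^N⌉` alike — mixes
  several twisted blocks into each target column.

`Idx`, `twist`, `ptrans`, `unitMat`, `SepCert` are problem-side definitions (no Literature notion).

## References

* D. Coppersmith, S. Winograd, *Matrix multiplication via arithmetic progressions*,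
  J. Symb. Comp. 9 (1990), §7 (the coupled blocks `T₀₁₁ + T₂₀₀`-type terms). [CoppersmithWinograd1990]
* M. Bläser, *Fast Matrix Multiplication*, Theory of Computing Graduate Surveys 5 (2013), §5,
  Def. 7.2 (restriction by substitution / zeroing out). [Blaser2013]
* M. Christandl, P. Vrana, J. Zuiddam, *Universal points in the asymptotic spectrum of tensors*,
  J. AMS 36 (2023), §1.1 (Kronecker powers, restriction). [ChristandlVranaZuiddam2023]
-/

noncomputable section

open scoped BigOperators Matrix

set_option linter.dupNamespace false
set_option autoImplicit false

namespace Summit.MatrixMultiplication.MatrixMultiplication.Theorems.OutsiderSandwichTwistGluing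

open Literature.Computability.AlgebraicComplexity
  Summit.MatrixMultiplication.MatrixMultiplication.Theorems.OutsiderSandwichCoupling
  Summit.MatrixMultiplication.MatrixMultiplication.Theorems.OutsiderSandwichBlockNormalForm

universe u

/-- Bit strings of length `N`: the row / column multi-indices of `M₂^{⊗N} ≅ M_{2^N}`. -/
abbrev Idx (N : ℕ) : Type := Fin N → Fin 2

variable {N : ℕ}

/-! ## 1. Partial transposes -/

/-- The **twist** of an index pair along the pattern `c`: swap the row bit and the column bit at
every position `i` with `c i = 1`. -/
def twist (c r s : Idx N) : Idx N × Idx N :=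
  (fun i => if c i = 1 then s i else r i, fun i => if c i = 1 then r i else s i)

/-- First component of a twist, coordinatewise. -/
@[simp] theorem twist_fst (c r s : Idx N) (i : Fin N) :
    (twist c r s).1 i = if c i = 1 then s i else r i := rfl

/-- Second component of a twist, coordinatewise. -/
@[simp] theorem twist_snd (c r s : Idx N) (i : Fin N) :
    (twist c r s).2 i = if c i = 1 then r i else s i := rfl

/-- `twist 0` is the identity. -/
theorem twist_zero (r s : Idx N) : twist 0 r s = (r, s) := by
  ext i <;> simp

/-- Every twist is an involution on index pairs. -/
theorem twist_twist (c r s : Idx N) : twist c (twist c r s).1 (twist c r s).2 = (r, s) := by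
  ext i <;> by_cases h : c i = 1 <;> simp [h]

/-- One coordinate of `twist_comp`. -/
private theorem comp_coord (a b x w : Fin 2) :
    (if b = 1 then (if a = 1 then x else w) else (if a = 1 then w else x)) =
      if b + a = 1 then w else x := by
  revert a b x w; decide

/-- One coordinate of `twist_add_one`. -/
private theorem add_one_coord (a x w : Fin 2) :
    (if a + 1 = 1 then w else x) = if a = 1 then x else w := by
  revert a x w; decide

/-- In `Fin 2`, `a + b = 0` forces `a = b`. -/
private theorem eq_of_add_eq_zero_coord (a b : Fin 2) (h : a + b = 0) : a = b := by
  revert a b; decide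

/-- In `Fin 2`, `a ≠ 1` forces `a = 0`. -/
private theorem eq_zero_of_ne_one_coord (a : Fin 2) (h : a ≠ 1) : a = 0 := by
  revert a; decide

/-- Composition of twists is addition of patterns (pointwise in `Fin 2`). -/
theorem twist_comp (c c' r s : Idx N) :
    twist c' (twist c r s).1 (twist c r s).2 = twist (c' + c) r s := by
  refine Prod.ext (funext fun i => ?_) (funext fun i => ?_)
  · simp only [twist_fst, twist_snd, Pi.add_apply]
    exact comp_coord (c i) (c' i) (r i) (s i)
  · simp only [twist_fst, twist_snd, Pi.add_apply]
    exact comp_coord (c i) (c' i) (s i) (r i)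

/-- The complementary pattern twists the swapped pair: `twist (c+1) r s = twist c s r`. -/
theorem twist_add_one (c r s : Idx N) : twist (c + 1) r s = twist c s r := by
  refine Prod.ext (funext fun i => ?_) (funext fun i => ?_)
  · simp only [twist_fst, Pi.add_apply, Pi.one_apply]
    exact add_one_coord (c i) (r i) (s i)
  · simp only [twist_snd, Pi.add_apply, Pi.one_apply]
    exact add_one_coord (c i) (s i) (r i)

/-- The two components of a twisted pair agree iff the pair was diagonal. -/
theorem twist_fst_eq_snd_iff (c r s : Idx N) : (twist c r s).1 = (twist c r s).2 ↔ r = s := by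
  constructor
  · intro h
    funext i
    have hi := congrFun h i
    simp only [twist_fst, twist_snd] at hi
    by_cases hc : c i = 1
    · rw [if_pos hc, if_pos hc] at hi; exact hi.symm
    · rw [if_neg hc, if_neg hc] at hi; exact hi
  · rintro rfl; rfl

/-- The **partial transpose** `τ_c` of a `2^N × 2^N` matrix along the pattern `c`:
`(τ_c X)_{r,s} = X_{r',s'}` where `(r', s')` is the `c`-twist of `(r, s)`. -/
def ptrans {R : Type u} (c : Idx N) (X : Matrix (Idx N) (Idx N) R) : Matrix (Idx N) (Idx N) R :=
  fun r s => X (twist c r s).1 (twist c r s).2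

/-- Entries of a partial transpose. -/
theorem ptrans_apply {R : Type u} (c : Idx N) (X : Matrix (Idx N) (Idx N) R) (r s : Idx N) :
    ptrans c X r s = X (twist c r s).1 (twist c r s).2 := rfl

/-- `τ_0 = id`. -/
theorem ptrans_zero {R : Type u} (X : Matrix (Idx N) (Idx N) R) : ptrans 0 X = X := by
  ext r s; rw [ptrans_apply, twist_zero]

/-- `τ_{1⋯1} = ` the full transpose. -/
theorem ptrans_one_eq_transpose {R : Type u} (X : Matrix (Idx N) (Idx N) R) :
    ptrans (1 : Idx N) X = Xᵀ := by
  ext r s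
  rw [ptrans_apply, Matrix.transpose_apply]
  simp only [twist, Pi.one_apply, if_true]

/-- `τ_c` is an involution. -/
theorem ptrans_ptrans {R : Type u} (c : Idx N) (X : Matrix (Idx N) (Idx N) R) :
    ptrans c (ptrans c X) = X := by
  ext r s; simp only [ptrans_apply, twist_twist]

/-- **Group law**: `τ_c ∘ τ_{c'} = τ_{c + c'}` — the partial transposes form the group `(ℤ/2)^N`. -/
theorem ptrans_comp {R : Type u} (c c' : Idx N) (X : Matrix (Idx N) (Idx N) R) :
    ptrans c (ptrans c' X) = ptrans (c' + c) X := by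
  ext r s; simp only [ptrans_apply, twist_comp]

/-- **Mirror law**: complementary patterns are transposes of each other, `τ_{c+1} X = (τ_c X)ᵀ`. -/
theorem ptrans_add_one {R : Type u} (c : Idx N) (X : Matrix (Idx N) (Idx N) R) :
    ptrans (c + 1) X = (ptrans c X)ᵀ := by
  ext r s; simp only [ptrans_apply, Matrix.transpose_apply, twist_add_one]

/-- Every partial transpose fixes the identity matrix. -/
theorem ptrans_one {R : Type u} [Zero R] [One R] (c : Idx N) :
    ptrans c (1 : Matrix (Idx N) (Idx N) R) = 1 := by
  ext r s
  simp only [ptrans_apply, Matrix.one_apply, twist_fst_eq_snd_iff]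

/-! ## 2. The no-untwisting lemma -/

section NoUntwisting

variable {R : Type u} [CommRing R]

/-- Matrix units `E_{a b}` on bit-string indices. -/
def unitMat (a b : Idx N) : Matrix (Idx N) (Idx N) R :=
  fun r s => if r = a ∧ s = b then 1 else 0

/-- Entries of a matrix unit. -/
theorem unitMat_apply (a b r s : Idx N) :
    (unitMat a b : Matrix (Idx N) (Idx N) R) r s = if r = a ∧ s = b then 1 else 0 := rfl

/-- `τ_c (E_{a b}) = E_{a' b'}` with `(a', b')` the `c`-twist of `(a, b)`. -/
theorem ptrans_unitMat (c a b : Idx N) :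
    ptrans c (unitMat a b : Matrix (Idx N) (Idx N) R) = unitMat (twist c a b).1 (twist c a b).2 := by
  ext r s
  simp only [ptrans_apply, unitMat_apply]
  refine if_congr ?_ rfl rfl
  constructor
  · rintro ⟨h1, h2⟩
    have h := twist_twist c r s
    rw [h1, h2] at h
    exact ⟨(congrArg Prod.fst h).symm, (congrArg Prod.snd h).symm⟩
  · rintro ⟨rfl, rfl⟩
    have h := twist_twist c a b
    exact ⟨congrArg Prod.fst h, congrArg Prod.snd h⟩

/-- `E_{a b} E_{b d} = E_{a d}`. -/
theorem unitMat_mul_unitMat (a b d : Idx N) :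
    (unitMat a b : Matrix (Idx N) (Idx N) R) * unitMat b d = unitMat a d := by
  ext r s
  rw [Matrix.mul_apply, Finset.sum_eq_single b]
  · simp only [unitMat_apply, and_true, true_and]
    by_cases hr : r = a <;> by_cases hs : s = d <;> simp [hr, hs]
  · intro j _ hj
    simp [unitMat_apply, hj]
  · intro h; exact absurd (Finset.mem_univ b) h

/-- **A nonzero partial transpose is not multiplicative.** -/
theorem ptrans_not_multiplicative [Nontrivial R] {c : Idx N} (hc : c ≠ 0) :
    ¬ ∀ X Y : Matrix (Idx N) (Idx N) R, ptrans c (X * Y) = ptrans c X * ptrans c Y := by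
  intro hmul
  obtain ⟨k, hk⟩ : ∃ k, c k = 1 := by
    by_contra h
    exact hc (funext fun i => eq_zero_of_ne_one_coord (c i) fun hi => h ⟨i, hi⟩)
  let r₀ : Idx N := fun _ => 0
  let r₁ : Idx N := fun i => if i = k then 1 else 0
  have h01 : r₀ ≠ r₁ := by
    intro h
    have := congrFun h k
    simp [r₀, r₁] at this
  have t01 : twist c r₀ r₁ = (r₁, r₀) := by
    ext i
    · by_cases hi : i = k
      · subst hi; simp [r₀, r₁, hk]
      · simp [r₀, r₁, hi]
    · by_cases hi : i = k
      · subst hi; simp [r₀, r₁, hk]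
      · simp [r₀, r₁, hi]
  have t10 : twist c r₁ r₀ = (r₀, r₁) := by
    ext i
    · by_cases hi : i = k
      · subst hi; simp [r₀, r₁, hk]
      · simp [r₀, r₁, hi]
    · by_cases hi : i = k
      · subst hi; simp [r₀, r₁, hk]
      · simp [r₀, r₁, hi]
  have t00 : twist c r₀ r₀ = (r₀, r₀) := by
    ext i <;> simp [r₀]
  have key := hmul (unitMat r₀ r₁) (unitMat r₁ r₀)
  rw [unitMat_mul_unitMat, ptrans_unitMat, ptrans_unitMat, ptrans_unitMat, t01, t10, t00,
    unitMat_mul_unitMat] at key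
  have e := congrFun (congrFun key r₀) r₀
  simp only [unitMat_apply, and_self, if_true, h01, if_false] at e
  exact one_ne_zero e

/-- **No-untwisting lemma (two-sided form).**  For `c ≠ 0` the partial transpose `τ_c` is not a
two-sided multiplication map `X ↦ G X H` (with ANY matrices `G, H`). -/
theorem ptrans_ne_sandwich [Nontrivial R] {c : Idx N} (hc : c ≠ 0)
    (G H : Matrix (Idx N) (Idx N) R) : ¬ ∀ X, ptrans c X = G * X * H := by
  intro h
  have hGH : G * H = 1 := by
    have := h 1
    rwa [ptrans_one, Matrix.mul_one, eq_comm] at this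
  have hHG : H * G = 1 := mul_eq_one_comm.1 hGH
  refine ptrans_not_multiplicative (R := R) hc (fun X Y => ?_)
  rw [h (X * Y), h X, h Y]
  calc G * (X * Y) * H = G * X * (H * G) * Y * H := by
        rw [hHG, Matrix.mul_one, Matrix.mul_assoc G X Y]
    _ = G * X * H * (G * Y * H) := by simp only [Matrix.mul_assoc]

/-- **No-untwisting lemma (vector-leg form).**  For `c ≠ 0` there are no matrices `G, H` acting on
the output and input vector legs with `G · τ_c(X) · H = X` for every `X`: a twisted
matrix–vector block of `C₁^{⊠N}` cannot be converted into an untwisted one by the vector legs. -/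
theorem ptrans_not_untwistable [Nontrivial R] {c : Idx N} (hc : c ≠ 0)
    (G H : Matrix (Idx N) (Idx N) R) : ¬ ∀ X, G * ptrans c X * H = X := by
  intro h
  have hGH : G * H = 1 := by
    have := h 1
    rwa [ptrans_one, Matrix.mul_one] at this
  have hHG : H * G = 1 := mul_eq_one_comm.1 hGH
  refine ptrans_ne_sandwich hc H G (fun X => ?_)
  calc ptrans c X = (H * G) * ptrans c X * (H * G) := by rw [hHG, Matrix.one_mul, Matrix.mul_one]
    _ = H * (G * ptrans c X * H) * G := by simp only [Matrix.mul_assoc]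
    _ = H * X * G := by rw [h X]

/-- The general twisted version: `τ_c(K X L) = K' X L'` for all `X`, with `K, L` invertible, forces
`c = 0`. -/
theorem eq_zero_of_ptrans_sandwich [Nontrivial R] {c : Idx N}
    {K L K' L' Kinv Linv : Matrix (Idx N) (Idx N) R} (hK : K * Kinv = 1) (hL : Linv * L = 1)
    (h : ∀ X, ptrans c (K * X * L) = K' * X * L') : c = 0 := by
  by_contra hc
  refine ptrans_ne_sandwich hc (K' * Kinv) (Linv * L') (fun Y => ?_)
  have := h (Kinv * Y * Linv)
  calc ptrans c Y = ptrans c (K * (Kinv * Y * Linv) * L) := by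
        congr 1
        calc Y = (K * Kinv) * Y * (Linv * L) := by rw [hK, hL, Matrix.one_mul, Matrix.mul_one]
          _ = K * (Kinv * Y * Linv) * L := by simp only [Matrix.mul_assoc]
    _ = K' * (Kinv * Y * Linv) * L' := this
    _ = K' * Kinv * Y * (Linv * L') := by simp only [Matrix.mul_assoc]

end NoUntwisting

/-! ## 3. Separable certificates have rate one -/

section Separable

variable {R : Type u} [CommRing R] {B : ℕ}

/-- A **column-separable exchange certificate** at level `N` with `B` copies: `x`-leg maps `A i`
(arbitrary functions on matrices — linearity is not even assumed), for every target column
`d : Idx N` ONE block `(copy d, pat d)` of `⟨B⟩ ⊠ C₁^{⊠N}` and vector-leg matrices `G d, H d`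
untwisting it (`G_d · τ_{c_d}(A_{i_d} X) · H_d = X` for all `X`), distinct columns using distinct
blocks. -/
structure SepCert (R : Type u) [CommRing R] (N B : ℕ) where
  /-- the `x`-leg map of copy `i` -/
  A : Fin B → Matrix (Idx N) (Idx N) R → Matrix (Idx N) (Idx N) R
  /-- the copy serving target column `d` -/
  copy : Idx N → Fin B
  /-- the twist pattern of the block serving target column `d` -/
  pat : Idx N → Idx N
  /-- distinct columns use distinct blocks -/
  inj : Function.Injective fun d => (copy d, pat d)
  /-- output-leg matrix of column `d` -/
  G : Idx N → Matrix (Idx N) (Idx N) R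
  /-- input-leg matrix of column `d` -/
  H : Idx N → Matrix (Idx N) (Idx N) R
  /-- the block reproduces `X` on column `d` -/
  ident : ∀ d X, G d * ptrans (pat d) (A (copy d) X) * H d = X

/-- In a separable certificate the `x`-leg map of the copy serving column `d` is FORCED:
`τ_{c_d}(A_{i_d} X) = K X L` with `K, L` the inverses of `G_d, H_d`. -/
theorem SepCert.sandwich (S : SepCert R N B) (d : Idx N) :
    ∃ K L : Matrix (Idx N) (Idx N) R, K * S.G d = 1 ∧ S.G d * K = 1 ∧ S.H d * L = 1 ∧
      L * S.H d = 1 ∧ ∀ X, ptrans (S.pat d) (S.A (S.copy d) X) = K * X * L := by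
  set T := ptrans (S.pat d) (S.A (S.copy d) 1) with hT
  have h1 : S.G d * T * S.H d = 1 := S.ident d 1
  have hGK : S.G d * (T * S.H d) = 1 := by rwa [← Matrix.mul_assoc]
  have hKG : (T * S.H d) * S.G d = 1 := mul_eq_one_comm.1 hGK
  have hLH : (S.G d * T) * S.H d = 1 := h1
  have hHL : S.H d * (S.G d * T) = 1 := mul_eq_one_comm.1 hLH
  refine ⟨T * S.H d, S.G d * T, hKG, hGK, hHL, hLH, fun X => ?_⟩
  have hX := S.ident d X
  calc ptrans (S.pat d) (S.A (S.copy d) X)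
      = (T * S.H d * S.G d) * ptrans (S.pat d) (S.A (S.copy d) X) * (S.H d * (S.G d * T)) := by
          rw [hKG, hHL, Matrix.one_mul, Matrix.mul_one]
    _ = T * S.H d * (S.G d * ptrans (S.pat d) (S.A (S.copy d) X) * S.H d) * (S.G d * T) := by
          simp only [Matrix.mul_assoc]
    _ = T * S.H d * X * (S.G d * T) := by rw [hX]

/-- **Each copy serves at most one column** in a separable certificate (the no-untwisting lemma:
two columns on the same copy would make `τ_{c+c'}` a two-sided multiplication map). -/
theorem SepCert.copy_injective [Nontrivial R] (S : SepCert R N B) : Function.Injective S.copy := by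
  intro d d' hdd
  obtain ⟨K, L, hKG, hGK, hHL, hLH, hd⟩ := S.sandwich d
  obtain ⟨K', L', -, -, -, -, hd'⟩ := S.sandwich d'
  -- `A_i X = τ_c (K X L)` and `τ_{c'} (A_i X) = K' X L'`, so `τ_{c' + c} (K X L) = K' X L'`.
  have key : ∀ X, ptrans (S.pat d + S.pat d') (K * X * L) = K' * X * L' := by
    intro X
    rw [← ptrans_comp, ← hd X, ptrans_ptrans, hdd]
    exact hd' X
  have hc : S.pat d + S.pat d' = 0 :=
    eq_zero_of_ptrans_sandwich (Kinv := S.G d) (Linv := S.H d) hKG hHL key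
  have hpat : S.pat d = S.pat d' :=
    funext fun i => eq_of_add_eq_zero_coord _ _ (by simpa using congrFun hc i)
  exact S.inj (Prod.ext hdd hpat)

/-- **Separable certificates have rate one: `B ≥ 2^N`.**  Every certificate for
`⟨B⟩ ⊠ C₁^{⊠N} ≥ ⟨2,2,2⟩^{⊠N}` with `B < 2^N` (lens 2's `⟨2⟩ ⊠ C₁^{⊠2} ≥ ⟨4,4,4⟩`, the symmetric
core `⌈(4/3)^N⌉`, …) therefore assembles some target column from at least two twisted blocks. -/
theorem two_pow_le_of_sepCert [Nontrivial R] (S : SepCert R N B) : 2 ^ N ≤ B := by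
  have h := Fintype.card_le_of_injective S.copy S.copy_injective
  simpa [Fintype.card_fin, Fintype.card_fun] using h

/-- Conversely the bound is attained: the trivial separable certificate with `B = 2^N` copies
(copy `d` untwisted, `A = id`, serving column `d` through block `0`). -/
def SepCert.trivial (N : ℕ) (e : Idx N ≃ Fin (2 ^ N)) : SepCert R N (2 ^ N) where
  A := fun _ X => X
  copy := e
  pat := fun _ => 0
  inj := fun d d' h => e.injective (congrArg Prod.fst h)
  G := fun _ => 1
  H := fun _ => 1
  ident := fun d X => by rw [ptrans_zero, Matrix.one_mul, Matrix.mul_one]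

/-- The index bijection used by `SepCert.trivial` exists. -/
theorem nonempty_sepCert_two_pow (N : ℕ) : Nonempty (SepCert R N (2 ^ N)) :=
  ⟨SepCert.trivial N (Fintype.equivFinOfCardEq (by simp))⟩

/-- **The separable exchange number is exactly `2^N`** (rate `1`). -/
theorem sepCert_iff [Nontrivial R] (N B : ℕ) :
    (Nonempty (SepCert R N B) ∧ ∀ B', Nonempty (SepCert R N B') → B ≤ B') ↔ B = 2 ^ N :=
  ⟨fun ⟨⟨S⟩, hmin⟩ => le_antisymm (hmin _ (nonempty_sepCert_two_pow N)) (two_pow_le_of_sepCert S),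
    fun h => h ▸ ⟨nonempty_sepCert_two_pow N, fun _ ⟨S⟩ => two_pow_le_of_sepCert S⟩⟩

end Separable

end Summit.MatrixMultiplication.MatrixMultiplication.Theorems.OutsiderSandwichTwistGluing
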